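import Summits.QuantumFields.BalabanUV.T4Continuum.Support.NE7FreeLandauFirstVariation
import Summits.QuantumFields.BalabanUV.T4Continuum.Support.NE7GradientCurrency
import HarnessLib

/-!
# NE7 — ESTIMATES ALONG A ONE-PARAMETER GAUGE SEGMENT `t ↦ e^{tη}` ON A BOX: the lattice path bound `‖η(x) − η(0)‖ ≤ |x|₁·max_b‖δ_b‖`, the
# small-field letters and the Euler–Lagrange defect of the conjugated links `e^{tη_x}V(x,κ)e^{−tη_{x'}}`, and the resulting quantitative lower
# bound on the second variation and upper bound on the first variation of the free-boundary trace link functional (F312b)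

Cell `pub-balaban`, rung (B)+1 sub-cell t4, lineage `b2b-balaban-t4-ne7-p1` (CRUX PROVER NE7 #1 = OWNER of row NE7), generation 93; memo
`t4/b2b-balaban-t4-ne7-p1-g93/UHLENBECK-ROAD.md` §4.  Over F311b `NE7TraceLinkHessianLower.hessian_lower`, F312a `NE7FreeLandauFirstVariation`
and (157) `NE7GradientCurrency` (`‖gh − 1‖ ≤ pq − 1`, `‖e^x − 1‖ ≤ e^ρ − 1`).

THE PICTURE (road U-IM).  `V` is the configuration at parameter `s + δ` seen in the previous Landau gauge: `‖V_b − 1‖ ≤ v₀` on the box bonds and its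
free-boundary Euler–Lagrange expression is `≤ e₀` (it was `0` at parameter `s`).  Along `t ↦ e^{tη}` (`η` skew, `‖η‖ ≤ ρ`, `t ∈ [0,1]`) the links
`L_t = e^{tη_x}V_be^{−tη_{x'}}` keep `‖L_t − 1‖ ≤ w := e^{2ρ}(1+v₀) − 1`, `‖L_t − V‖ ≤ (1+v₀)(e^{2ρ} − 1)`, hence an Euler–Lagrange defect
`≤ e₀ + 4d(1+v₀)(e^{2ρ} − 1)`; F311b then bounds the second variation below by `(1 − n·w − 2n·d·M·w)·D(η) − ρ²·M^d·(e₀ + 4d(1+v₀)(e^{2ρ}−1))`, and F312a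
bounds the first variation at `t = 0` by `½·M^d·ρ·e₀`.  With `η` pinned at `0` and large at some site, `D(η) ≥ θ²∕(n·d²·m²)` (§1) — the convexity
that excludes the boundary of the gauge ball in F312c.

WHAT ([folklore]; 0 def, 0 sorry): `norm_sub_zero_le_path` (§1), `norm_expConj_sub_one_le`, `norm_expConj_sub_self_le`, `norm_EL_sub_EL_le` (§2),
**`segment_secondVar_lower`**, **`segment_firstVar_abs_le`** (§3).
HONEST FRAMING (page 1): elementary; nothing of Bałaban's asserted; NE7 NOT PROVED here; spine 0∕9; finite T⁴ rung (B)+1 — NOT infinite volume, NOT mass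
gap, NOT `BetaPertH`, NOT Clay.  No `sorry`; axioms ⊆ {propext, Classical.choice, Quot.sound}.
-/

set_option autoImplicit false

open scoped BigOperators Matrix Matrix.Norms.L2Operator
open Finset NormedSpace Set

namespace Summit.QuantumFields.BalabanUV.T4Continuum.NE7FreeLandauSegment

open Literature.MathematicalPhysics.QuantumFieldTheory.Balaban1983to89
open B7Prop1Explicit UnitaryModel MatrixNorms
open T4AveragingDeficitWallBoundary (periodBox mem_periodBox card_periodBox)
open NE3HessBounds (nReTr_mul_comm nReTr_neg' opNorm_sq_div_card_le_nhsNormSq)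
open AveragingDeficitNearIdentity (abs_nReTr_mul_le)
open NE7GradientCurrency (norm_mul_sub_one_le_of_le norm_exp_sub_one_le)
open NE7TraceLinkHessianLower (hessian_lower norm_sq_le_card_mul_nhsNormSq)
open NE7FreeLandauFirstVariation (abs_firstVar_le)
open NE7BoxReflection (add_e_apply_ne sub_e_apply_ne)

noncomputable section

variable {d : ℕ} {n : Type*} [Fintype n] [DecidableEq n]

/-! ## §1 The lattice path bound inside the box -/

omit [Fintype n] [DecidableEq n] in
/-- **THE LATTICE PATH BOUND INSIDE THE BOX**: if every bond difference of `η` inside `periodBox M` is `≤ G` in norm, then for every `x` in the box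
`‖η x − η 0‖ ≤ (Σ_i x_i)·G` (descend one coordinate at a time; the path stays in the box). [folklore] -/
theorem norm_sub_zero_le_path {E : Type*} [SeminormedAddCommGroup E] {M : ℕ} (η : Site d → E) {G : ℝ}
    (hδ : ∀ (z : Site d) (κ : Fin d), z ∈ periodBox (d := d) M → z + e κ ∈ periodBox (d := d) M → ‖η (z + e κ) - η z‖ ≤ G) :
    ∀ (N : ℕ) (x : Site d), x ∈ periodBox (d := d) M → (∑ i, x i) = N → ‖η x - η 0‖ ≤ N * G := by
  intro N
  induction N with
  | zero =>
    intro x hx hsum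
    have hx0 : ∀ i, 0 ≤ x i := fun i => ((mem_periodBox.1 hx) i).1
    have hzero : ∀ i, x i = 0 := fun i => by
      have := (Finset.sum_eq_zero_iff_of_nonneg (fun j _ => hx0 j)).1 (by exact_mod_cast hsum) i (Finset.mem_univ i)
      exact this
    have : x = 0 := funext hzero
    subst this; simp
  | succ N ih =>
    intro x hx hsum
    have hx0 : ∀ i, 0 ≤ x i := fun i => ((mem_periodBox.1 hx) i).1
    -- some coordinate is positive
    obtain ⟨κ, hκ⟩ : ∃ κ, 0 < x κ := by
      by_contra h
      simp only [not_exists, not_lt] at h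
      have : (∑ i, x i) ≤ 0 := Finset.sum_nonpos fun i _ => h i
      omega
    -- step down along `κ`
    have hx' : x - e κ ∈ periodBox (d := d) M := by
      rw [mem_periodBox]
      intro i
      by_cases hi : i = κ
      · subst hi
        have h := (mem_periodBox.1 hx) i
        simp only [Pi.sub_apply, e_apply, if_true]
        omega
      · rw [sub_e_apply_ne x hi]; exact (mem_periodBox.1 hx) i
    have hsum' : (∑ i, (x - e κ) i) = N := by
      have h1 : (∑ i, (x - e κ) i) = (∑ i, x i) - 1 := by
        simp only [Pi.sub_apply, Finset.sum_sub_distrib, e_apply, Finset.sum_ite_eq', Finset.mem_univ, if_true]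
      rw [h1, hsum]; push_cast; ring
    have h1 := ih (x - e κ) hx' hsum'
    have h2 := hδ (x - e κ) κ hx' (by rw [sub_add_cancel]; exact hx)
    rw [sub_add_cancel] at h2
    calc ‖η x - η 0‖ ≤ ‖η x - η (x - e κ)‖ + ‖η (x - e κ) - η 0‖ := norm_sub_le_norm_sub_add_norm_sub _ _ _
      _ ≤ G + N * G := add_le_add h2 h1
      _ = ((N + 1 : ℕ) : ℝ) * G := by push_cast; ring

/-! ## §2 Letters of the conjugated links -/

variable [Nonempty n]

omit [Nonempty n] in
/-- **THE CONJUGATED LINK STAYS NEAR THE IDENTITY**: `‖e^{a}Ve^{−c} − 1‖ ≤ e^{2ρ}(1 + v) − 1` for `‖a‖, ‖c‖ ≤ ρ`, `‖V − 1‖ ≤ v`. [folklore] -/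
theorem norm_expConj_sub_one_le {a c V : Matrix n n ℂ} {ρ v : ℝ} (ha : ‖a‖ ≤ ρ) (hc : ‖c‖ ≤ ρ) (hV : ‖V - 1‖ ≤ v) :
    ‖exp a * V * exp (-c) - 1‖ ≤ Real.exp (2 * ρ) * (1 + v) - 1 := by
  have h1 : ‖exp a - 1‖ ≤ Real.exp ρ - 1 := norm_exp_sub_one_le ha
  have h2 : ‖V - 1‖ ≤ (1 + v) - 1 := by linarith
  have h3 : ‖exp (-c) - 1‖ ≤ Real.exp ρ - 1 := norm_exp_sub_one_le (by rwa [norm_neg])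
  have h12 := norm_mul_sub_one_le_of_le h1 h2
  have h := norm_mul_sub_one_le_of_le h12 h3
  calc _ ≤ Real.exp ρ * (1 + v) * Real.exp ρ - 1 := h
    _ = Real.exp (2 * ρ) * (1 + v) - 1 := by rw [show (2 : ℝ) * ρ = ρ + ρ by ring, Real.exp_add]; ring

/-- **THE CONJUGATED LINK STAYS NEAR THE LINK**: `‖e^{a}Ve^{−c} − V‖ ≤ (1 + v)(e^{2ρ} − 1)`. [folklore] -/
theorem norm_expConj_sub_self_le {a c V : Matrix n n ℂ} {ρ v : ℝ} (ha : ‖a‖ ≤ ρ) (hc : ‖c‖ ≤ ρ) (hV : ‖V - 1‖ ≤ v) :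
    ‖exp a * V * exp (-c) - V‖ ≤ (1 + v) * (Real.exp (2 * ρ) - 1) := by
  have hρ : 0 ≤ ρ := (norm_nonneg _).trans ha
  have h1 : ‖exp a - 1‖ ≤ Real.exp ρ - 1 := norm_exp_sub_one_le ha
  have h3 : ‖exp (-c) - 1‖ ≤ Real.exp ρ - 1 := norm_exp_sub_one_le (by rwa [norm_neg])
  have hV' : ‖V‖ ≤ 1 + v := by
    have := norm_le_norm_add_norm_sub' V 1  -- ‖V‖ ≤ ‖1‖ + ‖V − 1‖
    rw [norm_one] at this; linarith
  have he : ‖exp (-c)‖ ≤ Real.exp ρ := by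
    have := norm_le_norm_add_norm_sub' (exp (-c)) 1
    rw [norm_one] at this; linarith
  have hid : exp a * V * exp (-c) - V = (exp a - 1) * V * exp (-c) + V * (exp (-c) - 1) := by noncomm_ring
  rw [hid]
  have he0 : 0 ≤ Real.exp ρ - 1 := by linarith [Real.add_one_le_exp ρ, Real.exp_pos ρ]
  calc ‖(exp a - 1) * V * exp (-c) + V * (exp (-c) - 1)‖
      ≤ ‖exp a - 1‖ * ‖V‖ * ‖exp (-c)‖ + ‖V‖ * ‖exp (-c) - 1‖ := by
        refine (norm_add_le _ _).trans (add_le_add ?_ (norm_mul_le _ _))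
        exact (norm_mul_le _ _).trans (mul_le_mul_of_nonneg_right (norm_mul_le _ _) (norm_nonneg _))
    _ ≤ (Real.exp ρ - 1) * (1 + v) * Real.exp ρ + (1 + v) * (Real.exp ρ - 1) := by
        have hv0 : 0 ≤ 1 + v := (norm_nonneg _).trans hV'
        refine add_le_add ?_ (mul_le_mul hV' h3 (norm_nonneg _) hv0)
        exact mul_le_mul (mul_le_mul h1 hV' (norm_nonneg _) he0) he (norm_nonneg _) (mul_nonneg he0 hv0)
    _ = (1 + v) * (Real.exp (2 * ρ) - 1) := by rw [show (2 : ℝ) * ρ = ρ + ρ by ring, Real.exp_add]; ring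

omit [Nonempty n] in
/-- **THE EULER–LAGRANGE EXPRESSION IS LIPSCHITZ IN THE LINKS**: if `‖L_b − V_b‖ ≤ ℓ` on the box bonds then the free-boundary Euler–Lagrange
expressions of `L` and `V` differ by at most `4d·ℓ` at every site. [folklore] -/
theorem norm_EL_sub_EL_le (M : ℕ) (L V : Site d → Fin d → Matrix n n ℂ) {ℓ : ℝ} (hℓ : 0 ≤ ℓ)
    (h : ∀ (x : Site d) (κ : Fin d), x ∈ periodBox (d := d) M → x + e κ ∈ periodBox (d := d) M → ‖L x κ - V x κ‖ ≤ ℓ)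
    {x : Site d} (hx : x ∈ periodBox (d := d) M) :
    ‖(∑ κ : Fin d, ((if x + e κ ∈ periodBox (d := d) M then (L x κ - (L x κ)ᴴ) else 0)
        - (if x - e κ ∈ periodBox (d := d) M then (L (x - e κ) κ - (L (x - e κ) κ)ᴴ) else 0)))
      - (∑ κ : Fin d, ((if x + e κ ∈ periodBox (d := d) M then (V x κ - (V x κ)ᴴ) else 0)
        - (if x - e κ ∈ periodBox (d := d) M then (V (x - e κ) κ - (V (x - e κ) κ)ᴴ) else 0)))‖ ≤ 4 * d * ℓ := by
  have hodd : ∀ A B : Matrix n n ℂ, ‖(A - Aᴴ) - (B - Bᴴ)‖ ≤ 2 * ‖A - B‖ := by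
    intro A B
    rw [show (A - Aᴴ) - (B - Bᴴ) = (A - B) - (A - B)ᴴ by rw [Matrix.conjTranspose_sub]; abel]
    calc _ ≤ ‖A - B‖ + ‖(A - B)ᴴ‖ := norm_sub_le _ _
      _ = 2 * ‖A - B‖ := by rw [Matrix.l2_opNorm_conjTranspose]; ring
  rw [← Finset.sum_sub_distrib]
  calc _ ≤ ∑ κ : Fin d, (2 * ℓ + 2 * ℓ) := by
        refine norm_sum_le_of_le _ fun κ _ => ?_
        rw [show ∀ a b c e : Matrix n n ℂ, (a - b) - (c - e) = (a - c) - (b - e) from fun a b c e => by abel]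
        refine (norm_sub_le _ _).trans (add_le_add ?_ ?_)
        · by_cases hκ : x + e κ ∈ periodBox (d := d) M
          · rw [if_pos hκ, if_pos hκ]; exact (hodd _ _).trans (by linarith [h x κ hx hκ])
          · rw [if_neg hκ, if_neg hκ, sub_zero, norm_zero]; linarith
        · by_cases hκ : x - e κ ∈ periodBox (d := d) M
          · rw [if_pos hκ, if_pos hκ]
            have := h (x - e κ) κ hκ (by rw [sub_add_cancel]; exact hx)
            exact (hodd _ _).trans (by linarith)
          · rw [if_neg hκ, if_neg hκ, sub_zero, norm_zero]; linarith
    _ = 4 * d * ℓ := by rw [Finset.sum_const, Finset.card_univ, Fintype.card_fin, nsmul_eq_mul]; ring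

/-! ## §3 The second and first variations along the segment -/

set_option maxHeartbeats 1600000 in
/-- **THE SECOND VARIATION ALONG THE SEGMENT IS BOUNDED BELOW** (`d ≥ 1`, box `periodBox (m+1)`).  Let `V` be links with `‖V_b − 1‖ ≤ v₀` on the box
bonds and free-boundary Euler–Lagrange defect `≤ e₀` at every box site; let `η` be skew on the box with `‖η x‖ ≤ ρ` there, and `t ∈ [0,1]`.  With
`w = e^{2ρ}(1+v₀) − 1` and `L_t(x,κ) = e^{tη_x}V(x,κ)e^{−tη_{x+e_κ}}`, the bond sum of the second variations at `L_t` is at least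
`(1 − n·w − 2n·d·(m+1)·w)·D(η) − ρ²·(m+1)^d·(e₀ + 4d(1+v₀)(e^{2ρ} − 1))`. [folklore] -/
theorem segment_secondVar_lower (hd : 1 ≤ d) (m : ℕ) (V : Site d → Fin d → Matrix n n ℂ) {v₀ e₀ ρ : ℝ} (hv₀ : 0 ≤ v₀)
    (hρ : 0 ≤ ρ)
    (hV1 : ∀ (x : Site d) (κ : Fin d), x ∈ periodBox (d := d) (m + 1) → x + e κ ∈ periodBox (d := d) (m + 1) → ‖V x κ - 1‖ ≤ v₀)
    (hEL : ∀ x ∈ periodBox (d := d) (m + 1), ‖∑ κ : Fin d, ((if x + e κ ∈ periodBox (d := d) (m + 1) then (V x κ - (V x κ)ᴴ) else 0)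
      - (if x - e κ ∈ periodBox (d := d) (m + 1) then (V (x - e κ) κ - (V (x - e κ) κ)ᴴ) else 0))‖ ≤ e₀)
    (η : Site d → Matrix n n ℂ) (hη : ∀ x ∈ periodBox (d := d) (m + 1), η x ∈ skewAdjoint (Matrix n n ℂ))
    (hηρ : ∀ x ∈ periodBox (d := d) (m + 1), ‖η x‖ ≤ ρ) (hη0 : ∀ x, x ∉ periodBox (d := d) (m + 1) → η x = 0)
    {t : ℝ} (ht : t ∈ Icc (0 : ℝ) 1) :
    (1 - (Fintype.card n : ℝ) * (Real.exp (2 * ρ) * (1 + v₀) - 1)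
        - 2 * (Fintype.card n : ℝ) * d * (m + 1) * (Real.exp (2 * ρ) * (1 + v₀) - 1))
        * ∑ x ∈ periodBox (d := d) (m + 1), ∑ κ : Fin d,
            (if x + e κ ∈ periodBox (d := d) (m + 1) then nhsNormSq (η (x + e κ) - η x) else 0)
      - ρ ^ 2 * ((m + 1 : ℕ) : ℝ) ^ d * (e₀ + 4 * d * ((1 + v₀) * (Real.exp (2 * ρ) - 1)))
      ≤ ∑ x ∈ periodBox (d := d) (m + 1), ∑ κ : Fin d, (if x + e κ ∈ periodBox (d := d) (m + 1) then
          -nReTr (η x * (η x * (exp ((t : ℂ) • η x) * V x κ * exp (-((t : ℂ) • η (x + e κ))))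
              - (exp ((t : ℂ) • η x) * V x κ * exp (-((t : ℂ) • η (x + e κ)))) * η (x + e κ))
            - (η x * (exp ((t : ℂ) • η x) * V x κ * exp (-((t : ℂ) • η (x + e κ))))
              - (exp ((t : ℂ) • η x) * V x κ * exp (-((t : ℂ) • η (x + e κ)))) * η (x + e κ)) * η (x + e κ)) else 0) := by
  set pB := periodBox (d := d) (m + 1) with hpB
  set N : ℝ := (Fintype.card n : ℝ) with hN
  set w : ℝ := Real.exp (2 * ρ) * (1 + v₀) - 1 with hw_def
  set ℓ : ℝ := (1 + v₀) * (Real.exp (2 * ρ) - 1) with hℓ_def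
  set L : Site d → Fin d → Matrix n n ℂ := fun x κ => exp ((t : ℂ) • η x) * V x κ * exp (-((t : ℂ) • η (x + e κ))) with hL
  have he2 : 1 ≤ Real.exp (2 * ρ) := Real.one_le_exp (by positivity)
  have hw0 : 0 ≤ w := by rw [hw_def]; nlinarith
  have hℓ0 : 0 ≤ ℓ := by rw [hℓ_def]; exact mul_nonneg (by linarith) (by linarith)
  -- the scaled direction `t η` has norm `≤ ρ` everywhere
  have htη : ∀ x : Site d, ‖(t : ℂ) • η x‖ ≤ ρ := by
    intro x
    rw [norm_smul, Complex.norm_real, Real.norm_eq_abs, abs_of_nonneg ht.1]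
    by_cases hx : x ∈ pB
    · calc t * ‖η x‖ ≤ 1 * ρ := mul_le_mul ht.2 (hηρ x hx) (norm_nonneg _) zero_le_one
        _ = ρ := one_mul ρ
    · rw [hη0 x hx, norm_zero, mul_zero]; exact hρ
  -- letters of the conjugated links
  have hLw : ∀ (x : Site d) (κ : Fin d), x ∈ pB → x + e κ ∈ pB → ‖L x κ - 1‖ ≤ w := fun x κ hx hxκ =>
    norm_expConj_sub_one_le (htη x) (htη (x + e κ)) (hV1 x κ hx hxκ)
  have hLwa : ∀ (x : Site d) (κ : Fin d), x ∈ pB → x + e κ ∈ pB → ‖L x κ - (L x κ)ᴴ‖ ≤ 2 * w := by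
    intro x κ hx hxκ
    rw [show L x κ - (L x κ)ᴴ = (L x κ - 1) - (L x κ - 1)ᴴ by rw [Matrix.conjTranspose_sub, Matrix.conjTranspose_one]; abel]
    calc _ ≤ ‖L x κ - 1‖ + ‖(L x κ - 1)ᴴ‖ := norm_sub_le _ _
      _ ≤ w + w := by rw [Matrix.l2_opNorm_conjTranspose]; exact add_le_add (hLw x κ hx hxκ) (hLw x κ hx hxκ)
      _ = 2 * w := by ring
  have hLℓ : ∀ (x : Site d) (κ : Fin d), x ∈ pB → x + e κ ∈ pB → ‖L x κ - V x κ‖ ≤ ℓ := fun x κ hx hxκ =>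
    norm_expConj_sub_self_le (htη x) (htη (x + e κ)) (hV1 x κ hx hxκ)
  -- the Euler–Lagrange defect of `L`
  have hELL : ∀ x ∈ pB, ‖∑ κ : Fin d, ((if x + e κ ∈ pB then (L x κ - (L x κ)ᴴ) else 0)
      - (if x - e κ ∈ pB then (L (x - e κ) κ - (L (x - e κ) κ)ᴴ) else 0))‖ ≤ e₀ + 4 * d * ℓ := by
    intro x hx
    have h1 := norm_EL_sub_EL_le (m + 1) L V hℓ0 hLℓ hx
    have h2 := hEL x hx
    calc _ ≤ ‖(∑ κ : Fin d, ((if x + e κ ∈ pB then (L x κ - (L x κ)ᴴ) else 0) - (if x - e κ ∈ pB then (L (x - e κ) κ - (L (x - e κ) κ)ᴴ) else 0)))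
          - (∑ κ : Fin d, ((if x + e κ ∈ pB then (V x κ - (V x κ)ᴴ) else 0) - (if x - e κ ∈ pB then (V (x - e κ) κ - (V (x - e κ) κ)ᴴ) else 0)))‖
          + ‖∑ κ : Fin d, ((if x + e κ ∈ pB then (V x κ - (V x κ)ᴴ) else 0) - (if x - e κ ∈ pB then (V (x - e κ) κ - (V (x - e κ) κ)ᴴ) else 0))‖ :=
          norm_le_norm_sub_add _ _
      _ ≤ 4 * d * ℓ + e₀ := add_le_add h1 h2
      _ = e₀ + 4 * d * ℓ := by ring
  -- the Hessian lower bound at `L`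
  have hH := hessian_lower hd m η hη L hw0 (by positivity : (0 : ℝ) ≤ 2 * w) hLw hLwa
  -- the mean and the Euler–Lagrange term
  have hcard : ((periodBox (d := d) (m + 1)).card : ℝ) = ((m + 1 : ℕ) : ℝ) ^ d := by rw [card_periodBox]; push_cast; ring
  have hmean : ‖(((m + 1 : ℕ) : ℂ) ^ d)⁻¹ • ∑ z ∈ pB, η z‖ ≤ ρ := by
    rw [norm_smul, norm_inv, norm_pow, Complex.norm_natCast]
    have hM0 : (0 : ℝ) < ((m + 1 : ℕ) : ℝ) ^ d := by positivity
    rw [inv_mul_le_iff₀ hM0]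
    calc ‖∑ z ∈ pB, η z‖ ≤ ∑ z ∈ pB, ρ := norm_sum_le_of_le _ fun z hz => hηρ z hz
      _ = ((m + 1 : ℕ) : ℝ) ^ d * ρ := by rw [Finset.sum_const, nsmul_eq_mul, hcard]
  have hELsum : ∑ x ∈ pB, ‖η x‖ * ‖∑ κ : Fin d, ((if x + e κ ∈ pB then (L x κ - (L x κ)ᴴ) else 0)
      - (if x - e κ ∈ pB then (L (x - e κ) κ - (L (x - e κ) κ)ᴴ) else 0))‖ ≤ ((m + 1 : ℕ) : ℝ) ^ d * (ρ * (e₀ + 4 * d * ℓ)) := by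
    calc _ ≤ ∑ x ∈ pB, ρ * (e₀ + 4 * d * ℓ) := Finset.sum_le_sum fun x hx =>
          mul_le_mul (hηρ x hx) (hELL x hx) (norm_nonneg _) hρ
      _ = ((m + 1 : ℕ) : ℝ) ^ d * (ρ * (e₀ + 4 * d * ℓ)) := by rw [Finset.sum_const, nsmul_eq_mul, hcard]
  have hD0 : 0 ≤ ∑ x ∈ pB, ∑ κ : Fin d, (if x + e κ ∈ pB then nhsNormSq (η (x + e κ) - η x) else 0) :=
    Finset.sum_nonneg fun x _ => Finset.sum_nonneg fun κ _ => by
      split_ifs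
      · exact MatrixNorms.nhsNormSq_nonneg _
      · exact le_rfl
  have hprod : ‖(((m + 1 : ℕ) : ℂ) ^ d)⁻¹ • ∑ z ∈ pB, η z‖
      * ∑ x ∈ pB, ‖η x‖ * ‖∑ κ : Fin d, ((if x + e κ ∈ pB then (L x κ - (L x κ)ᴴ) else 0)
        - (if x - e κ ∈ pB then (L (x - e κ) κ - (L (x - e κ) κ)ᴴ) else 0))‖ ≤ ρ ^ 2 * ((m + 1 : ℕ) : ℝ) ^ d * (e₀ + 4 * d * ℓ) := by
    calc _ ≤ ρ * (((m + 1 : ℕ) : ℝ) ^ d * (ρ * (e₀ + 4 * d * ℓ))) :=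
          mul_le_mul hmean hELsum (Finset.sum_nonneg fun x _ => mul_nonneg (norm_nonneg _) (norm_nonneg _)) hρ
      _ = ρ ^ 2 * ((m + 1 : ℕ) : ℝ) ^ d * (e₀ + 4 * d * ℓ) := by ring
  have hcoef : (1 - N * w - N * d * (m + 1) * (2 * w)) = (1 - N * w - 2 * N * d * (m + 1) * w) := by ring
  rw [hcoef] at hH
  linarith [hH, hprod]

omit [Nonempty n] in
/-- **THE FIRST VARIATION AT THE START OF THE SEGMENT IS CONTROLLED BY THE EULER–LAGRANGE DEFECT**:
`|Σ_b Re tr(η_xV_b − V_bη_{x'})∕n| ≤ ½·(m+1)^d·ρ·e₀`. [folklore] -/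
theorem segment_firstVar_abs_le (m : ℕ) (V : Site d → Fin d → Matrix n n ℂ) {e₀ ρ : ℝ} (hρ : 0 ≤ ρ)
    (hEL : ∀ x ∈ periodBox (d := d) (m + 1), ‖∑ κ : Fin d, ((if x + e κ ∈ periodBox (d := d) (m + 1) then (V x κ - (V x κ)ᴴ) else 0)
      - (if x - e κ ∈ periodBox (d := d) (m + 1) then (V (x - e κ) κ - (V (x - e κ) κ)ᴴ) else 0))‖ ≤ e₀)
    (η : Site d → Matrix n n ℂ) (hη : ∀ x ∈ periodBox (d := d) (m + 1), η x ∈ skewAdjoint (Matrix n n ℂ))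
    (hηρ : ∀ x ∈ periodBox (d := d) (m + 1), ‖η x‖ ≤ ρ) :
    |∑ x ∈ periodBox (d := d) (m + 1), ∑ κ : Fin d, (if x + e κ ∈ periodBox (d := d) (m + 1) then
        nReTr (η x * V x κ - V x κ * η (x + e κ)) else 0)| ≤ (1 / 2) * (((m + 1 : ℕ) : ℝ) ^ d * (ρ * e₀)) := by
  have h := abs_firstVar_le (m + 1) η hη V
  have hcard : ((periodBox (d := d) (m + 1)).card : ℝ) = ((m + 1 : ℕ) : ℝ) ^ d := by rw [card_periodBox]; push_cast; ring
  -- the odd part of `D_V` is the Euler–Lagrange expression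
  have hodd : ∀ x : Site d, (∑ κ : Fin d, ((if x + e κ ∈ periodBox (d := d) (m + 1) then V x κ else 0)
      - (if x - e κ ∈ periodBox (d := d) (m + 1) then V (x - e κ) κ else 0)))
      - (∑ κ : Fin d, ((if x + e κ ∈ periodBox (d := d) (m + 1) then V x κ else 0)
      - (if x - e κ ∈ periodBox (d := d) (m + 1) then V (x - e κ) κ else 0)))ᴴ
      = ∑ κ : Fin d, ((if x + e κ ∈ periodBox (d := d) (m + 1) then (V x κ - (V x κ)ᴴ) else 0)
        - (if x - e κ ∈ periodBox (d := d) (m + 1) then (V (x - e κ) κ - (V (x - e κ) κ)ᴴ) else 0)) := by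
    intro x
    rw [Matrix.conjTranspose_sum, ← Finset.sum_sub_distrib]
    refine Finset.sum_congr rfl fun κ _ => ?_
    by_cases hp : x + e κ ∈ periodBox (d := d) (m + 1) <;> by_cases hq : x - e κ ∈ periodBox (d := d) (m + 1) <;>
      simp only [hp, hq, if_true, if_false, Matrix.conjTranspose_sub, Matrix.conjTranspose_zero, sub_zero, zero_sub, neg_sub,
        Matrix.conjTranspose_neg] <;> abel
  simp only [hodd] at h
  refine h.trans ?_
  refine mul_le_mul_of_nonneg_left ?_ (by norm_num)
  calc _ ≤ ∑ x ∈ periodBox (d := d) (m + 1), ρ * e₀ := Finset.sum_le_sum fun x hx =>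
        mul_le_mul (hηρ x hx) (hEL x hx) (norm_nonneg _) hρ
    _ = ((m + 1 : ℕ) : ℝ) ^ d * (ρ * e₀) := by rw [Finset.sum_const, nsmul_eq_mul, hcard]

end

end Summit.QuantumFields.BalabanUV.T4Continuum.NE7FreeLandauSegment
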